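import Literature.MathematicalPhysics.QuantumLattice.YangMillsHeatFlowContinuation
import Literature.Analysis.Calculus.EvolutionDerivBounds
import Literature.Analysis.Calculus.SmoothExtensionToClosure
import HarnessLib

/-!
# Yang–Mills heat flow: smooth extension to the final time from the `C^∞_loc` limit

Sorry-free progress on the named fact
`Literature.MathematicalPhysics.QuantumLattice.Waldron2019_yangMillsFlow_flatTorus` (Waldron 2019,
Cor. 1.2 with Struwe's short-time existence), refining the hypothesis `hW` of
`YangMillsHeatFlowContinuation.lean` to the printed form of **Waldron 2019, Thm. 1.1**: "Suppose
that `A(t)` is a smooth solution of (YM) over `M⁴ × [0, T)`, with `T < ∞` [and (1.1), automatic on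
a closed manifold] … Moreover, `lim_{t → T} A(t)` exists in `C^∞_loc`." The continuation argument
uses this in the form "the solution is the restriction of a map jointly smooth on the closed
slab `[0, T] × M`"; the passage from the one to the other — all time derivatives up to `t = T`
are controlled through the equation — is proved here on flat space `E` (finite-dimensional real
inner product space; coefficients in a finite-dimensional complete real normed algebra):

* `contDiffOn_Icc_of_smoothLimit` — a classical solution on `[0, T) × E` whose spatial
  derivatives of all orders converge locally uniformly to those of a smooth `B_T` as `t ↑ T` is,
  extended by `B_T`, jointly `C^∞` on `[0, T] × E`. Proof: near `t = T` the spatial derivatives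
  are bounded on bounded cylinders; the right-hand side of the flow is a smooth function of the
  2-jet (`exists_contDiff_divCurvature_eq`), so all space-time derivatives are bounded
  (`Literature.Analysis.Calculus.bounded_iteratedFDeriv_of_evolution`, Topping 2006, p. 47); a
  smooth function with bounded derivatives on a slab extends smoothly to the closed slab
  (`Literature.Analysis.Calculus.exists_contDiffOn_slab_extension`), and the extension at
  `t = T` is the `C⁰` limit `B_T`; smoothness is local.
* `exists_smoothExtension_of_smoothLimit` — the closed-slab form of Thm. 1.1 from the printed one.
* `Waldron2019_yangMillsFlow_flatTorus_of_shortTime_of_smoothLimit` — **the named fact from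
  Struwe's short-time existence (`hST`) and Waldron's Thm. 1.1 as printed (`hW`)**.

With `YangMillsHeatFlowDeTurck.lean` (`hST` from semilinear parabolic well-posedness) the named
fact rests on exactly two parabolic theorems, each now entering in its published form. Everything
is proved; no definition and no named fact is introduced.

References: A. Waldron, *Long-time existence for Yang–Mills flow*, Invent. Math. 217 (2019), §1,
Thm. 1.1, Cor. 1.2, p. 3 [Waldron2019]; P. Topping, *Lectures on the Ricci flow* (2006), §5.3,
p. 47 [Topping2006]; M. Struwe, Calc. Var. 2 (1994), §4 [Struwe1994].
-/

noncomputable section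

set_option maxSynthPendingDepth 3

open scoped ContDiff Topology
open Set Filter Metric

namespace Literature.MathematicalPhysics.QuantumLattice

/-! ### From the `C^∞_loc` limit at `t ↑ T` to joint smoothness on the closed slab -/

section FinalTime

open Literature.Analysis.Calculus

variable {E : Type*} [NormedAddCommGroup E] [InnerProductSpace ℝ E] [FiniteDimensional ℝ E]
variable {𝔸 : Type*} [NormedRing 𝔸] [NormedAlgebra ℝ 𝔸] [FiniteDimensional ℝ 𝔸] [CompleteSpace 𝔸]

omit [FiniteDimensional ℝ E] [FiniteDimensional ℝ 𝔸] [CompleteSpace 𝔸] in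
/-- Uniform convergence of the `0`-th iterated derivatives is uniform convergence of the values
(`iteratedFDeriv ℝ 0 f = curry₀⁻¹ ∘ f`, an isometry). [folklore] -/
theorem tendsto_of_tendstoLocallyUniformly_iteratedFDeriv_zero {ι : Type*} {p : Filter ι}
    {F : ι → E → (E →L[ℝ] 𝔸)} {f : E → (E →L[ℝ] 𝔸)}
    (h : TendstoLocallyUniformly (fun i y => iteratedFDeriv ℝ 0 (F i) y) (iteratedFDeriv ℝ 0 f) p)
    (y : E) : Tendsto (fun i => F i y) p (𝓝 (f y)) := by
  have h0 := (tendstoLocallyUniformlyOn_univ.2 h).tendsto_at (mem_univ y)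
  have hc : Continuous (continuousMultilinearCurryFin0 ℝ E (E →L[ℝ] 𝔸)) :=
    (continuousMultilinearCurryFin0 ℝ E (E →L[ℝ] 𝔸)).continuous
  have h1 := (hc.tendsto _).comp h0
  simp only [Function.comp_def, iteratedFDeriv_zero_eq_comp, LinearIsometryEquiv.apply_symm_apply]
    at h1
  exact h1

/-- **Smooth extension to the final time.** Let `B` be a classical solution of the Yang–Mills
heat flow on `[0, T) × E` (`T > 0`; jointly `C^∞` on `[0, T) × E`, solving
`∂ₜ B_v = Σ_μ D_μ F_{μ v}` on `(0, T)`), and suppose that `lim_{t ↑ T} B(t) = B_T` **exists in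
`C^∞_loc`**: `B_T` is smooth and for every `m` the spatial derivatives `D^m B(t)` converge to
`D^m B_T` locally uniformly on `E` as `t ↑ T` (the conclusion of Waldron 2019, Thm. 1.1). Then the
map extended by `B_T` at `t = T` is jointly `C^∞` on the closed slab `[0, T] × E`. Proof: near
`t = T` all spatial derivatives are bounded on bounded cylinders (convergence), hence — by the
equation, whose right-hand side is a smooth function of the 2-jet (`exists_contDiff_divCurvature_eq`)
— so are all space-time derivatives (`Literature.Analysis.Calculus.bounded_iteratedFDeriv_of_evolution`,
Topping 2006, p. 47), and a smooth function with bounded derivatives on a slab extends smoothly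
to the closed slab (`Literature.Analysis.Calculus.exists_contDiffOn_slab_extension`), the
extension being the `C⁰` limit `B_T` at `t = T`. [cite: Waldron2019, Thm. 1.1 and p. 3]
[cite: Topping2006, §5.3, p. 47] -/
theorem contDiffOn_Icc_of_smoothLimit {T : ℝ} (hT : 0 < T) {B : ℝ → Connection E 𝔸}
    {B_T : Connection E 𝔸}
    (hB : ContDiffOn ℝ ∞ (fun p : ℝ × E => B p.1 p.2) (Ico 0 T ×ˢ (univ : Set E)))
    (hpde : ∀ t ∈ Ioo 0 T, ∀ x v : E, deriv (fun s => B s x v) t = divCurvature (B t) x v)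
    (hBT : IsSmoothConnection B_T)
    (hlim : ∀ m : ℕ, TendstoLocallyUniformly (fun t y => iteratedFDeriv ℝ m (B t) y)
      (iteratedFDeriv ℝ m B_T) (𝓝[<] T)) :
    ContDiffOn ℝ ∞ (fun p : ℝ × E => (if p.1 < T then B p.1 else B_T) p.2)
      (Icc 0 T ×ˢ (univ : Set E)) := by
  -- space-time conventions: `u (y, t) = B t y`
  set u : E × ℝ → (E →L[ℝ] 𝔸) := fun q => B q.2 q.1 with hu
  have hu' : ContDiffOn ℝ ∞ u ((univ : Set E) ×ˢ Ico 0 T) := contDiffOn_swap_iff.2 hB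
  have hO : IsOpen ((univ : Set E) ×ˢ Ioo 0 T) := isOpen_univ.prod isOpen_Ioo
  have huO : ContDiffOn ℝ ∞ u ((univ : Set E) ×ˢ Ioo 0 T) :=
    hu'.mono (prod_mono le_rfl Ioo_subset_Ico_self)
  -- the equation in jet form
  obtain ⟨Θ, hΘc, hΘ⟩ := exists_contDiff_divCurvature_eq (E := E) (𝔸 := 𝔸)
  have hslice : ∀ t ∈ Ico 0 T, ContDiff ℝ ∞ (B t) := fun t ht =>
    contDiff_slice_of_contDiffOn_prod hB ht
  have heq : ∀ q ∈ (univ : Set E) ×ˢ Ioo 0 T,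
      dT u q = Θ (u q, dY u q, dY (dY u) q) := by
    rintro ⟨y, t⟩ ⟨-, ht⟩
    have hxD : dY u (y, t) = fderiv ℝ (B t) y := rfl
    have hxD2 : dY (dY u) (y, t) = fderiv ℝ (fderiv ℝ (B t)) y := by
      simp only [dY]
      rfl
    have h2 : ContDiff ℝ 2 (B t) :=
      (hslice t (Ioo_subset_Ico_self ht)).of_le (WithTop.coe_le_coe.mpr le_top)
    -- the time slice of `u` is differentiable at `t`
    have hd : DifferentiableAt ℝ (fun s => u (y, s)) t := by
      have hdu : DifferentiableAt ℝ u (y, t) :=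
        (huO.differentiableOn (by simp)).differentiableAt (hO.mem_nhds ⟨mem_univ y, ht⟩)
      exact hdu.comp t ((differentiableAt_const y).prodMk differentiableAt_id)
    rw [hxD, hxD2]
    refine ContinuousLinearMap.ext fun v => ?_
    have hd' : HasDerivAt (fun s => u (y, s)) (dT u (y, t)) t := by
      have h := hd.hasDerivAt
      simp only [dT]
      exact h
    have hv : HasDerivAt (fun s => u (y, s) v) (dT u (y, t) v) t := by
      simpa using hd'.clm_apply (hasDerivAt_const t v)
    have hpde' : deriv (fun s => u (y, s) v) t = divCurvature (B t) y v := hpde t ht y v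
    rw [← hv.deriv, hpde', hΘ (B t) h2 y v]
  -- local smoothness on the closed slab, around every point `y₀`
  have hloc : ∀ y₀ : E, ContDiffOn ℝ ∞ (fun q : E × ℝ => if q.2 < T then u q else B_T q.1)
      (ball y₀ 1 ×ˢ Icc 0 T) := by
    intro y₀
    set t₁ : ℝ := T / 2 with ht₁
    have ht₁0 : 0 < t₁ := by positivity
    have ht₁T : t₁ < T := by rw [ht₁]; linarith
    set Ω : Set (E × ℝ) := ball y₀ 1 ×ˢ Ioo t₁ T with hΩ
    have hΩo : IsOpen Ω := isOpen_ball.prod isOpen_Ioo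
    have hΩO : Ω ⊆ (univ : Set E) ×ˢ Ioo 0 T :=
      prod_mono (subset_univ _) (Ioo_subset_Ioo_left ht₁0.le)
    have hρ : ∀ q ∈ Ω, ‖q.1‖ ≤ ‖y₀‖ + 1 := by
      rintro ⟨y, t⟩ ⟨hy, -⟩
      have : dist y y₀ < 1 := hy
      rw [dist_eq_norm] at this
      linarith [norm_le_norm_add_norm_sub' y y₀, norm_sub_rev y y₀]
    -- all spatial derivatives are bounded on `Ω`
    have hSB : SpatiallyBdd Ω u := by
      refine ⟨huO.mono hΩO, fun m => ?_⟩
      -- near `T`: uniform convergence on the compact ball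
      have hK : IsCompact (closedBall y₀ 1) := isCompact_closedBall y₀ 1
      have hunif := (tendstoLocallyUniformly_iff_forall_isCompact.1 (hlim m)) _ hK
      obtain ⟨M, hM⟩ : ∃ M, ∀ y ∈ closedBall y₀ 1, ‖iteratedFDeriv ℝ m B_T y‖ ≤ M :=
        hK.exists_bound_of_continuousOn
          ((ContDiff.continuous_iteratedFDeriv (WithTop.coe_le_coe.mpr le_top) hBT).continuousOn)
      have hev := (Metric.tendstoUniformlyOn_iff.1 hunif) 1 one_pos
      obtain ⟨tm, htmT, htm⟩ : ∃ tm < T, ∀ t ∈ Ioo tm T, ∀ y ∈ closedBall y₀ 1,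
          dist (iteratedFDeriv ℝ m B_T y) (iteratedFDeriv ℝ m (B t) y) < 1 := by
        obtain ⟨tm, htmT, hsub⟩ := (mem_nhdsLT_iff_exists_Ioo_subset).1 hev
        exact ⟨tm, htmT, fun t ht => hsub ht⟩
      -- away from `T`: continuity on a compact cylinder
      set s : ℝ := max t₁ tm with hs
      have hsT : s < T := max_lt ht₁T htmT
      have hcpt : IsCompact (closedBall y₀ 1 ×ˢ Icc t₁ s) := hK.prod isCompact_Icc
      have hsubO : closedBall y₀ 1 ×ˢ Icc t₁ s ⊆ (univ : Set E) ×ˢ Ioo 0 T :=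
        prod_mono (subset_univ _) fun t ht => ⟨ht₁0.trans_le ht.1, ht.2.trans_lt hsT⟩
      have hcont : ContinuousOn (dYk m u) (closedBall y₀ 1 ×ˢ Icc t₁ s) :=
        ((contDiffOn_dYk hO huO m).continuousOn).mono hsubO
      obtain ⟨M₁, hM₁⟩ := hcpt.exists_bound_of_continuousOn hcont
      refine ⟨max M₁ (M + 1), ?_⟩
      rintro ⟨y, t⟩ ⟨hy, ht⟩
      by_cases hts : t ≤ s
      · exact (hM₁ (y, t) ⟨ball_subset_closedBall hy, ht.1.le, hts⟩).trans (le_max_left _ _)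
      · have htm' : t ∈ Ioo tm T := ⟨(le_max_right t₁ tm).trans_lt (not_le.1 hts), ht.2⟩
        have hd := htm t htm' y (ball_subset_closedBall hy)
        rw [dist_eq_norm] at hd
        have hle : ‖iteratedFDeriv ℝ m (B t) y‖ ≤ M + 1 := by
          have h1 := norm_sub_norm_le (iteratedFDeriv ℝ m (B t) y) (iteratedFDeriv ℝ m B_T y)
          have h2 : ‖iteratedFDeriv ℝ m (B t) y - iteratedFDeriv ℝ m B_T y‖ < 1 := by
            rw [← norm_neg, neg_sub]; exact hd
          linarith [hM y (ball_subset_closedBall hy)]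
        exact hle.trans (le_max_right _ _)
    -- the 2-jet of `u` stays in a compact set of jets
    obtain ⟨C₀, hC₀⟩ := hSB.norm_le
    obtain ⟨C₁, hC₁⟩ := (hSB.spatiallyBdd_dY hΩo).norm_le
    obtain ⟨C₂, hC₂⟩ := ((hSB.spatiallyBdd_dY hΩo).spatiallyBdd_dY hΩo).norm_le
    set K : Set (E × (E →L[ℝ] 𝔸) × (E →L[ℝ] E →L[ℝ] 𝔸) × (E →L[ℝ] E →L[ℝ] E →L[ℝ] 𝔸)) :=
      closedBall 0 (‖y₀‖ + 1) ×ˢ (closedBall 0 C₀ ×ˢ (closedBall 0 C₁ ×ˢ closedBall 0 C₂)) with hKdef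
    have hKc : IsCompact K :=
      (isCompact_closedBall _ _).prod ((isCompact_closedBall _ _).prod
        ((isCompact_closedBall _ _).prod (isCompact_closedBall _ _)))
    have hrange : ∀ q ∈ Ω, (q.1, u q, dY u q, dY (dY u) q) ∈ K := fun q hq =>
      ⟨mem_closedBall_zero_iff.2 (hρ q hq), mem_closedBall_zero_iff.2 (hC₀ q hq),
        mem_closedBall_zero_iff.2 (hC₁ q hq), mem_closedBall_zero_iff.2 (hC₂ q hq)⟩
    have hR : ContDiffOn ℝ ∞ (fun J : E × (E →L[ℝ] 𝔸) × (E →L[ℝ] E →L[ℝ] 𝔸) ×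
        (E →L[ℝ] E →L[ℝ] E →L[ℝ] 𝔸) => Θ J.2) univ := (hΘc.comp contDiff_snd).contDiffOn
    have hb := bounded_iteratedFDeriv_of_evolution hΩo hρ hSB isOpen_univ hKc (subset_univ _) hR
      hrange (fun q hq => heq q (hΩO hq))
    -- smooth extension to the closed slab over the ball
    obtain ⟨W, hWs, hWeq, hWlim⟩ := exists_contDiffOn_slab_extension (V := univ) (a := 0)
      (y₀ := y₀) (r := 1) hu' (subset_univ _) ht₁0.le ht₁T hb
    -- the extension is `B_T` at `t = T`
    have hWT : ∀ y ∈ ball y₀ 1, W (y, T) = B_T y := by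
      intro y hy
      have h1 := hWlim y hy
      have h2 : Tendsto (fun t => u (y, t)) (𝓝[<] T) (𝓝 (B_T y)) :=
        tendsto_of_tendstoLocallyUniformly_iteratedFDeriv_zero (hlim 0) y
      exact tendsto_nhds_unique h1 h2
    refine hWs.congr ?_
    rintro ⟨y, t⟩ ⟨hy, ht⟩
    by_cases htT : t < T
    · simp only [htT, if_true]
      exact (hWeq ⟨hy, ht.1, htT⟩).symm
    · have htT' : t = T := le_antisymm ht.2 (not_lt.1 htT)
      subst htT'
      simp only [lt_irrefl, if_false]
      exact (hWT y hy).symm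
  -- global smoothness on the closed slab, and back to the `ℝ × E` convention
  have hglob : ContDiffOn ℝ ∞ (fun q : E × ℝ => if q.2 < T then u q else B_T q.1)
      ((univ : Set E) ×ˢ Icc 0 T) := by
    refine contDiffOn_of_locally_contDiffOn fun q hq => ⟨ball q.1 1 ×ˢ univ,
      isOpen_ball.prod isOpen_univ, ⟨mem_ball_self one_pos, mem_univ _⟩, ?_⟩
    have hset : (univ : Set E) ×ˢ Icc 0 T ∩ ball q.1 1 ×ˢ (univ : Set ℝ) = ball q.1 1 ×ˢ Icc 0 T := by
      ext ⟨y, t⟩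
      simp only [mem_inter_iff, mem_prod, mem_univ, true_and, and_true]
      tauto
    rw [hset]
    exact hloc q.1
  have hform : (fun q : E × ℝ => if q.2 < T then u q else B_T q.1) =
      fun q : E × ℝ => (fun t => if t < T then B t else B_T) q.2 q.1 := by
    funext q
    simp only [hu]
    split_ifs <;> rfl
  rw [hform] at hglob
  exact (contDiffOn_swap_iff (A := fun t => if t < T then B t else B_T) (S := Icc 0 T)).1 hglob

/-- **Closed-slab extension from the `C^∞_loc` limit**: the form of Waldron's Thm. 1.1 used in the
continuation argument (`hW` of `Waldron2019_yangMillsFlow_flatTorus_of_shortTime_of_smoothExtension`)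
from its printed form ("`lim_{t → T} A(t)` exists in `C^∞_loc`"). [cite: Waldron2019, Thm. 1.1] -/
theorem exists_smoothExtension_of_smoothLimit {T : ℝ} (hT : 0 < T) {B : ℝ → Connection E 𝔸}
    (hB : ContDiffOn ℝ ∞ (fun p : ℝ × E => B p.1 p.2) (Ico 0 T ×ˢ (univ : Set E)))
    (hpde : ∀ t ∈ Ioo 0 T, ∀ x v : E, deriv (fun s => B s x v) t = divCurvature (B t) x v)
    (hlim : ∃ B_T : Connection E 𝔸, IsSmoothConnection B_T ∧
      ∀ m : ℕ, TendstoLocallyUniformly (fun t y => iteratedFDeriv ℝ m (B t) y)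
        (iteratedFDeriv ℝ m B_T) (𝓝[<] T)) :
    ∃ B' : ℝ → Connection E 𝔸, (∀ t : ℝ, 0 ≤ t → t < T → B' t = B t) ∧
      ContDiffOn ℝ ∞ (fun p : ℝ × E => B' p.1 p.2) (Icc 0 T ×ˢ (univ : Set E)) := by
  obtain ⟨B_T, hBT, hl⟩ := hlim
  refine ⟨fun t => if t < T then B t else B_T, fun t _ ht => by simp [ht], ?_⟩
  exact contDiffOn_Icc_of_smoothLimit hT hB hpde hBT hl

end FinalTime

/-! ### The named fact from short-time existence and Waldron's Thm. 1.1 as printed -/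

section Torus

open scoped Matrix.Norms.Frobenius

/-- **`Waldron2019_yangMillsFlow_flatTorus` from Struwe's short-time existence and Waldron's
Thm. 1.1 in its printed form.** `hST`: short-time existence of classical solutions for smooth
periodic `𝔲(N)`-valued data (Struwe 1994; reduced to semilinear parabolic theory in
`YangMillsHeatFlowDeTurck.lean`). `hW`: **Waldron 2019, Thm. 1.1** for the trivial
`U(N)`-bundle over the closed flat torus `ℝ⁴/Lℤ⁴` (where hypothesis (1.1) "is immediate from the
global energy identity", Waldron p. 3; cf. `YangMillsHeatFlowEnergy.lean`), last sentence as
printed: for a smooth solution of (YM) over `M × [0, T)`, `T < ∞`, **"`lim_{t → T} A(t)` exists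
in `C^∞_loc`"** — there is a smooth connection `A_T` to which all spatial derivatives of `A(t)`
converge locally uniformly as `t ↑ T`. Everything else — the smooth extension to `[0, T]`
(`contDiffOn_Icc_of_smoothLimit`), restart, junction, maximal solutions (Cor. 1.2) and the
passage to flow lines — is proved. [cite: Waldron2019, Thm. 1.1, Cor. 1.2 and p. 3]
[cite: Struwe1994, §4 (local existence)] -/
theorem Waldron2019_yangMillsFlow_flatTorus_of_shortTime_of_smoothLimit
    (hST : ∀ (N : ℕ) (L : ℝ), 0 < L →
      ∀ A₀ : Connection (EuclideanSpace ℝ (Fin 4)) (Matrix (Fin N) (Fin N) ℂ),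
        IsSmoothConnection A₀ →
        A₀.IsValuedIn (skewAdjoint.submodule ℝ (Matrix (Fin N) (Fin N) ℂ)) →
        A₀.IsLatticePeriodic L →
        ∃ ε : ℝ, 0 < ε ∧
          ∃ A : ℝ → Connection (EuclideanSpace ℝ (Fin 4)) (Matrix (Fin N) (Fin N) ℂ),
            A 0 = A₀ ∧
            ContDiffOn ℝ ∞ (fun p : ℝ × EuclideanSpace ℝ (Fin 4) => A p.1 p.2)
              (Ico 0 ε ×ˢ univ) ∧
            (∀ t : ℝ, 0 ≤ t → t < ε → (A t).IsLatticePeriodic L) ∧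
            (∀ t : ℝ, 0 < t → t < ε →
              (A t).IsValuedIn (skewAdjoint.submodule ℝ (Matrix (Fin N) (Fin N) ℂ))) ∧
            ∀ t : ℝ, 0 < t → t < ε → ∀ x v : EuclideanSpace ℝ (Fin 4),
              deriv (fun s => A s x v) t = divCurvature (A t) x v)
    (hW : ∀ (N : ℕ) (L : ℝ), 0 < L → ∀ T : ℝ, 0 < T →
      ∀ B : ℝ → Connection (EuclideanSpace ℝ (Fin 4)) (Matrix (Fin N) (Fin N) ℂ),
        ContDiffOn ℝ ∞ (fun p : ℝ × EuclideanSpace ℝ (Fin 4) => B p.1 p.2) (Ico 0 T ×ˢ univ) →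
        (∀ t : ℝ, 0 ≤ t → t < T → (B t).IsLatticePeriodic L) →
        (∀ t : ℝ, 0 < t → t < T →
          (B t).IsValuedIn (skewAdjoint.submodule ℝ (Matrix (Fin N) (Fin N) ℂ))) →
        (∀ t : ℝ, 0 < t → t < T → ∀ x v : EuclideanSpace ℝ (Fin 4),
          deriv (fun s => B s x v) t = divCurvature (B t) x v) →
        ∃ B_T : Connection (EuclideanSpace ℝ (Fin 4)) (Matrix (Fin N) (Fin N) ℂ),
          IsSmoothConnection B_T ∧
          ∀ m : ℕ, TendstoLocallyUniformly (fun t y => iteratedFDeriv ℝ m (B t) y)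
            (iteratedFDeriv ℝ m B_T) (𝓝[<] T)) :
    Waldron2019_yangMillsFlow_flatTorus :=
  Waldron2019_yangMillsFlow_flatTorus_of_shortTime_of_smoothExtension hST
    fun N L hL T hT B hBs hBp hBv hBpde =>
      exists_smoothExtension_of_smoothLimit hT hBs (fun t ht x v => hBpde t ht.1 ht.2 x v)
        (hW N L hL T hT B hBs hBp hBv hBpde)

end Torus

end Literature.MathematicalPhysics.QuantumLattice
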